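/-
Copyright: harness tree, Literature layer (sorry-free). b2b-lace carver-g49 (CARVER gen 49), FAR-FIELD class seeds
(lean1-g40 `farfield-question`, STATUS 2026-08-22T23:18:57Z): the seed enclosures at `D = 10` at the far-field class(es) of the
one-step class identity at `6e₀`, as hypothesis-free theorems (what-if / input-certification lane; record certificate untouched).
Companion of `SrwSeedEnclD10` (`x = 0`), carver-g30's `SrwSeedEnclD10Classes` (seventeen classes), carver-g31's
`SrwSeedEnclD10ClassesX` (nine classes) and carver-g45's `SrwSeedEnclD10ClassesY` (three classes), whose `clsPt` /
`coordD_clsPt_of_coords` it reuses by name.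
-/
import Literature.Probability.FitznerVanDerHofstad2017.SrwSeedEnclD10Classes
import Literature.Probability.FitznerVanDerHofstad2017.SrwSeedCertD10V000002

/-!
# Seed enclosures `lo n ≤ I_{n,0}(x; 10) ≤ hi n`, `n = 1..4`, at one further class — THEOREMS

For the coordinate class `v000002 = [6, 6]` (naming = digit `k` counts the coordinates equal to `k`) the four seed
integrals `I_{n,0}(x_v; 10) = srwI 10 n 0 x_v` of the recursion (5.1) lie in the literal rational intervals
`[cert_d10_<v>.lo n, cert_d10_<v>.hi n]` of the kernel-decided class certificate `SrwSeedCertD10V<v>` — by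
`SeedCert.Cert.soundD` (`SrwSeedCertSoundD`) applied to its four `decide +kernel` theorems, through the landed bridge
`coordD_clsPt_of_coords` (`SrwSeedEnclD10Classes`: the zero-padded coordinate list of the class point IS the
certificate's `avalsD 10`, decided per class).  Here `x_v = clsPt 10 (coords v) = fun k => (coords v).getD k 0`.
The class `[6, 6]` is the point `6e₀ + 6e₁`, one of the two FAR-FIELD nodes of the one-step class identity
`W_{n,j}(6e₀; 10) = (I_{n,2j}(0) + I_{n,2j}(12e₀))/20 + (9/10)·I_{n,2j}(6e₀+6e₁)` (the twenty neighbours `6e₀ ± 6e_μ`;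
cf. `SrwKTwoSupD10.w6`, where both nodes are so far majorised by positionwise domination `KTUD10.termDom`, i.e. by the
class `[6]`); the other node `12e₀` (class `[12]`) has no certificate of this kernel at feasible cost (the `[T,∞)`
Hankel bracket of order `12` needs `T ≳ 144`) and is not part of this file.  With this file the seed at `6e₀ + 6e₁`,
`n ≤ 4`, is a tree literal (shape (hs) of `srwI_encl_of_tables`, `SrwIntegralTableRecursion`).  Radii: `hi n - lo n = 2 R_n`,
`R = (4e-24, 1e-22, 4e-22, 4e-21)` (uniform with the 29 landed off-origin classes).  Nothing about the record dimension
is touched; no cited fact is added (the certificates are self-contained kernel arithmetic + the tree's analysis of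
`srwI`); no numerics-engine value is a hypothesis.

[cite: FitznerVanDerHofstad2016NoBLE, §5.1.1 (5.4)–(5.5) pp. 1089–1090]
-/

namespace Literature.Probability.FitznerVanDerHofstad2017.SeedCert

open Literature.Probability.FitznerVanDerHofstad2017.SrwCount (coordD)

/-- **Seed enclosures, class `v000002` (`x = [6, 6]`), `D = 10`**: `lo n ≤ srwI 10 n 0 x ≤ hi n` for `1 ≤ n ≤ 4`, with
`lo`/`hi` the literal rationals of `cert_d10_v000002` (shape (hs) of `srwI_encl_of_tables`). [cite: FitznerVanDerHofstad2016NoBLE, §5.1.1 (5.4)–(5.5) pp. 1089–1090] -/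
theorem srwI_seed_encl_d10_v000002 (n : ℕ) (hn1 : 1 ≤ n) (hn4 : n ≤ 4) :
    ((cert_d10_v000002.lo n : ℚ) : ℝ) ≤ srwI 10 n 0 (clsPt 10 [6, 6]) ∧ srwI 10 n 0 (clsPt 10 [6, 6]) ≤ ((cert_d10_v000002.hi n : ℚ) : ℝ) :=
  cert_d10_v000002.soundD 10 cert_d10_v000002_params cert_d10_v000002_poisson cert_d10_v000002_tail cert_d10_v000002_final (clsPt 10 [6, 6])
    (coordD_clsPt_of_coords cert_d10_v000002 10 [6, 6] (by decide) (by decide)) n hn1 hn4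

end Literature.Probability.FitznerVanDerHofstad2017.SeedCert
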